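import Mathlib
import HarnessLib
import Literature.Combinatorics.SimpleGraph.LasserreStableBound
import Summits.PneNP.PneNP.Theses.RamseyUncertifiable
import Summits.PneNP.PneNP.Theorems.RamseyUncertifiablePaleySosRungInducedMonotone

/-!
# Route `RamseyUncertifiable`, item `SosUncertainty` (stmt-PneNP-9815) — Lasserre's bound under
# graph operations, and super-additivity / super-multiplicativity of the uncertainty product

Write `las_t = Literature.Combinatorics.SimpleGraph.lasserreStableBound` (Laurent's program (22)) and
`f_t(G) := las_t(G) · las_t(Gᶜ)` for the UNCERTAINTY PRODUCT of the crux `SosUncertainty`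
(`UP_t : f_t(G) ≥ n^δ`). This file proves, sorry-free, how `las_t` and `f_t` behave under the
basic graph operations — the book-keeping every analysis of a candidate family (`m·C₅`, lexicographic
powers `C₅^[k]`, `P_q^[k]`, blow-ups) has used informally in the crux notes (Disproof (c), triage
r1-2 T2, r1-3 F4):

* `isLasserreFeasible_restrict` — feasibility RESTRICTS along an embedding `f : W ↪ V` to the induced
  subgraph `G.comap f` (`S ↦ y (S.map f)`, a principal submatrix of `M_t(y)`).
* `isLasserreFeasible_prodVec` — the PRODUCT moment vector `K ↦ y (K.image fst) · z (K.image snd)`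
  of feasible `y` (for `G`) and `z` (for `H`) is feasible for every graph `P` on `V × W` whose edges
  project to an edge of `G` or an edge of `H` (the disjunctive / co-normal product and all its
  subgraphs: lexicographic, strong, Cartesian, tensor); its moment matrix is a principal submatrix of
  the Kronecker product `M_t(y) ⊗ₖ M_t(z)` (Mathlib `Matrix.PosSemidef.kronecker`).
* `mul_le_lasserreStableBound_of_adj` — hence SUPER-MULTIPLICATIVITY `las_t(G) · las_t(H) ≤ las_t(P)`
  for such `P` (`t ≥ 1`).
* `isLasserreFeasible_sumVec`, `lasserreStableBound_sum` — ADDITIVITY over disjoint unions: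
  `las_t(G ⊕g H) = las_t(G) + las_t(H)` (`t ≥ 1`; product vector `K ↦ y K.toLeft · z K.toRight` one
  way, restriction the other way).
* `lasserreStableBound_compl_le_compl_sum_left/right` — the JOIN `(G ⊕g H)ᶜ` of `Gᶜ` and `Hᶜ`
  dominates both: `las_t(Gᶜ) ≤ las_t((G ⊕g H)ᶜ)` (induced monotonicity, tree
  `PaleySosRungWeilPatchTransfer.stub_inducedMonotone`). (The reverse inequality
  `las_t((G ⊕g H)ᶜ) ≤ max`, true, is not needed here and not proved.)
* `uncertaintyProduct_sum_ge` — SUPER-ADDITIVITY of the uncertainty product over disjoint unions: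
  `f_t(G) + f_t(H) ≤ f_t(G ⊕g H)`; by `f_t(Xᶜ) = f_t(X)` the same holds over joins. Consequence for
  the crux: in the constant form of `UP_t` (`c n^δ ≤ f_t`, see
  `RamseyUncertifiableSosUncertaintyReductions.lean`) a minimal counterexample family may be taken
  connected and co-connected, since `c n₁^δ + c n₂^δ ≥ c (n₁ + n₂)^δ` for `δ ≤ 1`.
* `uncertaintyProduct_lex_ge` — SUPER-MULTIPLICATIVITY over lexicographic products:
  `f_t(G) · f_t(H) ≤ f_t(G[H])` for any `P = G[H]` (adjacency `G.Adj x.1 y.1 ∨ (x.1 = y.1 ∧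
  H.Adj x.2 y.2)`; its complement is `Gᶜ[Hᶜ]`). Consequence: on the lexicographic powers of ANY
  fixed graph `H` on `m ≥ 2` vertices `UP_t` holds with exponent `log f_t(H) / log m ≥ log 2 / log m`
  (`f_t(H^[k]) ≥ f_t(H)^k`, `f_t(H) ≥ α(H) ω(H) ≥ 2`), e.g. `f₂(C₅^[k]) ≥ 4^k = n^{0.861…}`.

All statements are for Laurent's `las_t` WITHOUT nonnegativity; the same proofs work verbatim for
the `ϑ′`-type variant. Sources: the constructions are the standard tensoring / direct-sum of
(pseudo-)moment sequences [folklore]; for `t = 1` (`ϑ`) they are Lovász 1979 / Knuth 1994 §§18–21.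
-/

-- the Theorems namespace `Summit.PneNP.PneNP.Theorems` is prescribed by the tree layout
set_option linter.dupNamespace false

namespace Summit.PneNP.PneNP.Theorems.SosUncertainty

open Literature.Combinatorics.SimpleGraph Finset Matrix
open scoped Kronecker
open Summit.PneNP.PneNP.Theorems.PaleySosRungWeilPatchTransfer (stub_inducedMonotone)

variable {V W : Type*} [Fintype V] [DecidableEq V] [Fintype W] [DecidableEq W]

/-! ### Restriction along an embedding -/

omit [Fintype V] [Fintype W] in
/-- **Restriction.** If `y` is Lasserre-feasible for `G` at level `t` and `f : W ↪ V`, then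
`S ↦ y (S.map f)` is feasible for the induced subgraph `G.comap f`: its moment matrix is the
principal submatrix of `M_t(y)` on the sets `S.map f`. [folklore] -/
theorem isLasserreFeasible_restrict {G : SimpleGraph V} {t : ℕ} {y : Finset V → ℝ}
    (hy : IsLasserreFeasible G t y) (f : W ↪ V) :
    IsLasserreFeasible (G.comap f) t (fun S : Finset W => y (S.map f)) where
  empty_eq_one := by simp [hy.empty_eq_one]
  pair_eq_zero := by
    intro u v huv
    have h : ({u, v} : Finset W).map f = {f u, f v} := by simp [map_insert]
    simpa [h] using hy.pair_eq_zero huv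
  posSemidef := by
    have h := hy.posSemidef.submatrix
      (fun S : {S : Finset W // S.card ≤ t} => (⟨S.1.map f, (card_map f).le.trans S.2⟩ :
        {S : Finset V // S.card ≤ t}))
    convert h using 1
    ext I J
    simp [momentMatrix_apply, map_union]

/-! ### Products: tensoring two feasible moment vectors -/

/-- **Product vector.** For `y` feasible for `G` and `z` feasible for `H` (level `t`), the vector
`K ↦ y (K.image fst) · z (K.image snd)` on subsets of `V × W` is feasible for every graph `P` on
`V × W` each of whose edges projects to an edge of `G` in the first or an edge of `H` in the second
coordinate. Its moment matrix is the principal submatrix of `M_t(y) ⊗ₖ M_t(z)` on the pairs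
`(K.image fst, K.image snd)`. [folklore] -/
theorem isLasserreFeasible_prodVec {G : SimpleGraph V} {H : SimpleGraph W}
    {P : SimpleGraph (V × W)} (hP : ∀ x x', P.Adj x x' → G.Adj x.1 x'.1 ∨ H.Adj x.2 x'.2)
    {t : ℕ} {y : Finset V → ℝ} {z : Finset W → ℝ}
    (hy : IsLasserreFeasible G t y) (hz : IsLasserreFeasible H t z) :
    IsLasserreFeasible P t
      (fun K : Finset (V × W) => y (K.image Prod.fst) * z (K.image Prod.snd)) where
  empty_eq_one := by simp [hy.empty_eq_one, hz.empty_eq_one]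
  pair_eq_zero := by
    intro x x' hxx'
    rcases hP x x' hxx' with h | h
    · have h0 : y (({x, x'} : Finset (V × W)).image Prod.fst) = 0 := by
        rw [image_insert, image_singleton]; exact hy.pair_eq_zero h
      simp only [h0, zero_mul]
    · have h0 : z (({x, x'} : Finset (V × W)).image Prod.snd) = 0 := by
        rw [image_insert, image_singleton]; exact hz.pair_eq_zero h
      simp only [h0, mul_zero]
  posSemidef := by
    let e : {K : Finset (V × W) // K.card ≤ t} →
        {S : Finset V // S.card ≤ t} × {T : Finset W // T.card ≤ t} :=
      fun K => (⟨K.1.image Prod.fst, card_image_le.trans K.2⟩,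
        ⟨K.1.image Prod.snd, card_image_le.trans K.2⟩)
    have h := (hy.posSemidef.kronecker hz.posSemidef).submatrix e
    have hM : momentMatrix t (fun K : Finset (V × W) => y (K.image Prod.fst) * z (K.image Prod.snd))
        = (momentMatrix t y ⊗ₖ momentMatrix t z).submatrix e e := by
      ext I J
      simp [momentMatrix_apply, image_union, e, Matrix.kroneckerMap_apply]
    rw [hM]
    exact h

/-- Value of the product vector: `Σ_x y({x}.fst) z({x}.snd) = (Σ_v y_v)(Σ_w z_w)`. [folklore] -/
theorem sum_prodVec_singleton (y : Finset V → ℝ) (z : Finset W → ℝ) :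
    ∑ x : V × W, y (({x} : Finset (V × W)).image Prod.fst) * z (({x} : Finset (V × W)).image Prod.snd)
      = (∑ v, y {v}) * ∑ w, z {w} := by
  simp only [image_singleton]
  rw [Fintype.sum_prod_type, sum_mul_sum]

/-- **Super-multiplicativity of `las_t` over products.** If every edge of `P` (on `V × W`) projects
to an edge of `G` or of `H` — the disjunctive product and all its spanning subgraphs, e.g. the
lexicographic, strong, Cartesian and categorical products — then
`las_t(G) · las_t(H) ≤ las_t(P)` (`t ≥ 1`). [folklore] -/
theorem mul_le_lasserreStableBound_of_adj {G : SimpleGraph V} {H : SimpleGraph W}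
    {P : SimpleGraph (V × W)} (hP : ∀ x x', P.Adj x x' → G.Adj x.1 x'.1 ∨ H.Adj x.2 x'.2)
    {t : ℕ} (ht : 1 ≤ t) :
    lasserreStableBound G t * lasserreStableBound H t ≤ lasserreStableBound P t := by
  -- for a fixed feasible `z` of `H`
  have step : ∀ z, IsLasserreFeasible H t z →
      lasserreStableBound G t * ∑ w, z {w} ≤ lasserreStableBound P t := by
    intro z hz
    have hs : 0 ≤ ∑ w, z {w} :=
      sum_nonneg fun w _ => hz.apply_nonneg (by rw [card_singleton]; exact ht)
    rcases hs.eq_or_lt with h0 | hpos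
    · rw [← h0, mul_zero]; exact lasserreStableBound_nonneg P t ht
    · rw [← le_div_iff₀ hpos]
      refine lasserreStableBound_le_of_forall fun y hy => ?_
      rw [le_div_iff₀ hpos, ← sum_prodVec_singleton]
      exact (isLasserreFeasible_prodVec hP hy hz).sum_singleton_le_lasserreStableBound ht
  have hG : 0 ≤ lasserreStableBound G t := lasserreStableBound_nonneg G t ht
  rcases hG.eq_or_lt with h0 | hpos
  · rw [← h0, zero_mul]; exact lasserreStableBound_nonneg P t ht
  · rw [mul_comm, ← le_div_iff₀ hpos]
    refine lasserreStableBound_le_of_forall fun z hz => ?_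
    rw [le_div_iff₀ hpos, mul_comm]
    exact step z hz

/-! ### Disjoint unions -/

omit [Fintype V] [DecidableEq V] [Fintype W] [DecidableEq W] in
/-- `toLeft` of a singleton `{inl v}`. [folklore] -/
theorem toLeft_singleton_inl (v : V) : ({(Sum.inl v : V ⊕ W)} : Finset (V ⊕ W)).toLeft = {v} := by
  ext; simp

omit [Fintype V] [DecidableEq V] [Fintype W] [DecidableEq W] in
/-- `toRight` of a singleton `{inl v}`. [folklore] -/
theorem toRight_singleton_inl (v : V) : ({(Sum.inl v : V ⊕ W)} : Finset (V ⊕ W)).toRight = ∅ := by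
  ext; simp

omit [Fintype V] [DecidableEq V] [Fintype W] [DecidableEq W] in
/-- `toLeft` of a singleton `{inr w}`. [folklore] -/
theorem toLeft_singleton_inr (w : W) : ({(Sum.inr w : V ⊕ W)} : Finset (V ⊕ W)).toLeft = ∅ := by
  ext; simp

omit [Fintype V] [DecidableEq V] [Fintype W] [DecidableEq W] in
/-- `toRight` of a singleton `{inr w}`. [folklore] -/
theorem toRight_singleton_inr (w : W) : ({(Sum.inr w : V ⊕ W)} : Finset (V ⊕ W)).toRight = {w} := by
  ext; simp

/-- **Sum vector.** For `y` feasible for `G` and `z` feasible for `H` (level `t`), the vector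
`K ↦ y K.toLeft · z K.toRight` is feasible for the disjoint union `G ⊕g H`; its moment matrix is the
principal submatrix of `M_t(y) ⊗ₖ M_t(z)` on the pairs `(K.toLeft, K.toRight)`. [folklore] -/
theorem isLasserreFeasible_sumVec {G : SimpleGraph V} {H : SimpleGraph W}
    {t : ℕ} {y : Finset V → ℝ} {z : Finset W → ℝ}
    (hy : IsLasserreFeasible G t y) (hz : IsLasserreFeasible H t z) :
    IsLasserreFeasible (G ⊕g H) t (fun K : Finset (V ⊕ W) => y K.toLeft * z K.toRight) where
  empty_eq_one := by
    have h1 : (∅ : Finset (V ⊕ W)).toLeft = ∅ := by ext; simp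
    have h2 : (∅ : Finset (V ⊕ W)).toRight = ∅ := by ext; simp
    simp [h1, h2, hy.empty_eq_one, hz.empty_eq_one]
  pair_eq_zero := by
    rintro (u | u) (v | v) huv
    · have h : y ({Sum.inl u, Sum.inl v} : Finset (V ⊕ W)).toLeft = 0 := by
        rw [toLeft_insert_inl, toLeft_singleton_inl]
        exact hy.pair_eq_zero ((SimpleGraph.sum_adj_inl).1 huv)
      simp only [h, zero_mul]
    · simp at huv
    · simp at huv
    · have h : z ({Sum.inr u, Sum.inr v} : Finset (V ⊕ W)).toRight = 0 := by
        rw [toRight_insert_inr, toRight_singleton_inr]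
        exact hz.pair_eq_zero ((SimpleGraph.sum_adj_inr).1 huv)
      simp only [h, mul_zero]
  posSemidef := by
    let e : {K : Finset (V ⊕ W) // K.card ≤ t} →
        {S : Finset V // S.card ≤ t} × {T : Finset W // T.card ≤ t} :=
      fun K => (⟨K.1.toLeft, card_toLeft_le.trans K.2⟩, ⟨K.1.toRight, card_toRight_le.trans K.2⟩)
    have h := (hy.posSemidef.kronecker hz.posSemidef).submatrix e
    have hM : momentMatrix t (fun K : Finset (V ⊕ W) => y K.toLeft * z K.toRight)
        = (momentMatrix t y ⊗ₖ momentMatrix t z).submatrix e e := by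
      ext I J
      simp [momentMatrix_apply, toLeft_union, toRight_union, e, Matrix.kroneckerMap_apply]
    rw [hM]
    exact h

/-- Value of the sum vector: `Σ_x y(x.toLeft) z(x.toRight) = Σ_v y_v + Σ_w z_w` (using
`y_∅ = z_∅ = 1`). [folklore] -/
theorem sum_sumVec_singleton {G : SimpleGraph V} {H : SimpleGraph W} {t : ℕ}
    {y : Finset V → ℝ} {z : Finset W → ℝ}
    (hy : IsLasserreFeasible G t y) (hz : IsLasserreFeasible H t z) :
    ∑ x : V ⊕ W, y (({x} : Finset (V ⊕ W)).toLeft) * z (({x} : Finset (V ⊕ W)).toRight)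
      = ∑ v, y {v} + ∑ w, z {w} := by
  rw [Fintype.sum_sum_type]
  simp only [toLeft_singleton_inl, toRight_singleton_inl, toLeft_singleton_inr,
    toRight_singleton_inr, hy.empty_eq_one, hz.empty_eq_one, mul_one, one_mul]

omit [Fintype V] [DecidableEq V] [Fintype W] [DecidableEq W] in
/-- The left part of a disjoint union, as an induced subgraph: `(G ⊕g H).comap inl = G`. [folklore] -/
theorem comap_inl_sum (G : SimpleGraph V) (H : SimpleGraph W) :
    (G ⊕g H).comap (Function.Embedding.inl : V ↪ V ⊕ W) = G := by
  ext u v; simp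

omit [Fintype V] [DecidableEq V] [Fintype W] [DecidableEq W] in
/-- The right part of a disjoint union, as an induced subgraph: `(G ⊕g H).comap inr = H`. [folklore] -/
theorem comap_inr_sum (G : SimpleGraph V) (H : SimpleGraph W) :
    (G ⊕g H).comap (Function.Embedding.inr : W ↪ V ⊕ W) = H := by
  ext u v; simp

omit [Fintype V] [DecidableEq V] [Fintype W] [DecidableEq W] in
/-- The left part of a join: `(G ⊕g H)ᶜ.comap inl = Gᶜ`. [folklore] -/
theorem comap_inl_compl_sum (G : SimpleGraph V) (H : SimpleGraph W) :
    (G ⊕g H)ᶜ.comap (Function.Embedding.inl : V ↪ V ⊕ W) = Gᶜ := by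
  ext u v; simp [SimpleGraph.compl_adj]

omit [Fintype V] [DecidableEq V] [Fintype W] [DecidableEq W] in
/-- The right part of a join: `(G ⊕g H)ᶜ.comap inr = Hᶜ`. [folklore] -/
theorem comap_inr_compl_sum (G : SimpleGraph V) (H : SimpleGraph W) :
    (G ⊕g H)ᶜ.comap (Function.Embedding.inr : W ↪ V ⊕ W) = Hᶜ := by
  ext u v; simp [SimpleGraph.compl_adj]

/-- **Additivity of `las_t` over disjoint unions**: `las_t(G ⊕g H) = las_t(G) + las_t(H)`
(`t ≥ 1`). `≥`: the sum vector; `≤`: a feasible vector of `G ⊕g H` restricts to feasible vectors of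
`G` and of `H` whose values add up to its value. [folklore] -/
theorem lasserreStableBound_sum (G : SimpleGraph V) (H : SimpleGraph W) {t : ℕ} (ht : 1 ≤ t) :
    lasserreStableBound (G ⊕g H) t = lasserreStableBound G t + lasserreStableBound H t := by
  refine le_antisymm (lasserreStableBound_le_of_forall fun Y hY => ?_) ?_
  · -- restriction to the two parts
    have hG := (comap_inl_sum G H) ▸ isLasserreFeasible_restrict hY Function.Embedding.inl
    have hH := (comap_inr_sum G H) ▸ isLasserreFeasible_restrict hY Function.Embedding.inr
    have h1 := hG.sum_singleton_le_lasserreStableBound ht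
    have h2 := hH.sum_singleton_le_lasserreStableBound ht
    simp only [map_singleton, Function.Embedding.inl_apply, Function.Embedding.inr_apply] at h1 h2
    rw [Fintype.sum_sum_type]
    exact add_le_add h1 h2
  · -- `las G + las H ≤ las (G ⊕g H)`: two suprema, one at a time
    have step : ∀ z, IsLasserreFeasible H t z →
        lasserreStableBound G t + ∑ w, z {w} ≤ lasserreStableBound (G ⊕g H) t := by
      intro z hz
      rw [← le_sub_iff_add_le]
      refine lasserreStableBound_le_of_forall fun y hy => ?_
      rw [le_sub_iff_add_le, ← sum_sumVec_singleton hy hz]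
      exact (isLasserreFeasible_sumVec hy hz).sum_singleton_le_lasserreStableBound ht
    rw [add_comm, ← le_sub_iff_add_le]
    refine lasserreStableBound_le_of_forall fun z hz => ?_
    rw [le_sub_iff_add_le, add_comm]
    exact step z hz

/-- **The join dominates its parts (left)**: `las_t(Gᶜ) ≤ las_t((G ⊕g H)ᶜ)` — `(G ⊕g H)ᶜ` is the
join of `Gᶜ` and `Hᶜ`, which contains `Gᶜ` as an induced subgraph. [folklore] -/
theorem lasserreStableBound_compl_le_compl_sum_left (G : SimpleGraph V) (H : SimpleGraph W)
    {t : ℕ} (ht : 1 ≤ t) :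
    lasserreStableBound Gᶜ t ≤ lasserreStableBound (G ⊕g H)ᶜ t := by
  have h := stub_inducedMonotone (G ⊕g H)ᶜ (Function.Embedding.inl : V ↪ V ⊕ W) ht
  rwa [comap_inl_compl_sum] at h

/-- **The join dominates its parts (right)**: `las_t(Hᶜ) ≤ las_t((G ⊕g H)ᶜ)`. [folklore] -/
theorem lasserreStableBound_compl_le_compl_sum_right (G : SimpleGraph V) (H : SimpleGraph W)
    {t : ℕ} (ht : 1 ≤ t) :
    lasserreStableBound Hᶜ t ≤ lasserreStableBound (G ⊕g H)ᶜ t := by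
  have h := stub_inducedMonotone (G ⊕g H)ᶜ (Function.Embedding.inr : W ↪ V ⊕ W) ht
  rwa [comap_inr_compl_sum] at h

/-! ### The uncertainty product `f_t(G) = las_t(G) · las_t(Gᶜ)` -/

/-- **Super-additivity of the uncertainty product over disjoint unions** (and, by
`f_t(Xᶜ) = f_t(X)`, over joins): `f_t(G) + f_t(H) ≤ f_t(G ⊕g H)` for `t ≥ 1`. -/
theorem uncertaintyProduct_sum_ge :
    ∀ {V W : Type} [Fintype V] [DecidableEq V] [Fintype W] [DecidableEq W]
      (G : SimpleGraph V) (H : SimpleGraph W) {t : ℕ}, 1 ≤ t →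
      lasserreStableBound G t * lasserreStableBound Gᶜ t
          + lasserreStableBound H t * lasserreStableBound Hᶜ t
        ≤ lasserreStableBound (G ⊕g H) t * lasserreStableBound (G ⊕g H)ᶜ t := by
  intro V W _ _ _ _ G H t ht
  rw [lasserreStableBound_sum G H ht, add_mul]
  exact add_le_add
    (mul_le_mul_of_nonneg_left (lasserreStableBound_compl_le_compl_sum_left G H ht)
      (lasserreStableBound_nonneg G t ht))
    (mul_le_mul_of_nonneg_left (lasserreStableBound_compl_le_compl_sum_right G H ht)
      (lasserreStableBound_nonneg H t ht))

omit [Fintype V] [DecidableEq V] [Fintype W] [DecidableEq W] in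
/-- The complement of a lexicographic product `G[H]` is the lexicographic product `Gᶜ[Hᶜ]`; in
particular every edge of `G[H]ᶜ` projects to an edge of `Gᶜ` or of `Hᶜ`. [folklore] -/
theorem compl_lex_adj_imp {G : SimpleGraph V} {H : SimpleGraph W} {P : SimpleGraph (V × W)}
    (hP : ∀ x x', P.Adj x x' ↔ G.Adj x.1 x'.1 ∨ (x.1 = x'.1 ∧ H.Adj x.2 x'.2)) :
    ∀ x x', Pᶜ.Adj x x' → Gᶜ.Adj x.1 x'.1 ∨ Hᶜ.Adj x.2 x'.2 := by
  intro x x' h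
  rw [SimpleGraph.compl_adj, hP] at h
  obtain ⟨hne, hnot⟩ := h
  by_cases h1 : x.1 = x'.1
  · right
    refine ⟨fun h2 => hne (Prod.ext h1 h2), fun hadj => hnot (Or.inr ⟨h1, hadj⟩)⟩
  · left
    exact ⟨h1, fun hadj => hnot (Or.inl hadj)⟩

/-- **Super-multiplicativity of the uncertainty product over lexicographic products**:
for `P = G[H]` (adjacency `G.Adj x.1 y.1 ∨ (x.1 = y.1 ∧ H.Adj x.2 y.2)`),
`f_t(G) · f_t(H) ≤ f_t(G[H])` (`t ≥ 1`): `G[H]` lies below the disjunctive product of `G, H` and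
`G[H]ᶜ = Gᶜ[Hᶜ]` below that of `Gᶜ, Hᶜ`. Hence `f_t(H^[k]) ≥ f_t(H)^k`: `UP_t` holds on the
lexicographic powers of every fixed graph with `≥ 2` vertices. -/
theorem uncertaintyProduct_lex_ge {G : SimpleGraph V} {H : SimpleGraph W} {P : SimpleGraph (V × W)}
    (hP : ∀ x x', P.Adj x x' ↔ G.Adj x.1 x'.1 ∨ (x.1 = x'.1 ∧ H.Adj x.2 x'.2)) {t : ℕ} (ht : 1 ≤ t) :
    (lasserreStableBound G t * lasserreStableBound Gᶜ t)
        * (lasserreStableBound H t * lasserreStableBound Hᶜ t)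
      ≤ lasserreStableBound P t * lasserreStableBound Pᶜ t := by
  have h1 : lasserreStableBound G t * lasserreStableBound H t ≤ lasserreStableBound P t :=
    mul_le_lasserreStableBound_of_adj (fun x x' h => by
      rcases (hP x x').1 h with h' | ⟨_, h'⟩
      · exact Or.inl h'
      · exact Or.inr h') ht
  have h2 : lasserreStableBound Gᶜ t * lasserreStableBound Hᶜ t ≤ lasserreStableBound Pᶜ t :=
    mul_le_lasserreStableBound_of_adj (compl_lex_adj_imp hP) ht
  calc (lasserreStableBound G t * lasserreStableBound Gᶜ t)
        * (lasserreStableBound H t * lasserreStableBound Hᶜ t)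
      = (lasserreStableBound G t * lasserreStableBound H t)
        * (lasserreStableBound Gᶜ t * lasserreStableBound Hᶜ t) := by ring
    _ ≤ lasserreStableBound P t * lasserreStableBound Pᶜ t :=
        mul_le_mul h1 h2 (mul_nonneg (lasserreStableBound_nonneg Gᶜ t ht)
          (lasserreStableBound_nonneg Hᶜ t ht)) (lasserreStableBound_nonneg P t ht)

omit [Fintype V] [DecidableEq V] [Fintype W] [DecidableEq W] in
/-- The complement of a graph ABOVE the strong product lies BELOW the disjunctive product of the
complements: if `P.Adj x y` whenever `(x.1 = y.1 ∨ G.Adj x.1 y.1) ∧ (x.2 = y.2 ∨ H.Adj x.2 y.2)`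
(`x ≠ y`), then every edge of `Pᶜ` projects to an edge of `Gᶜ` or of `Hᶜ`. [folklore] -/
theorem compl_adj_imp_of_strong_le {G : SimpleGraph V} {H : SimpleGraph W} {P : SimpleGraph (V × W)}
    (hP : ∀ x y, x ≠ y → (x.1 = y.1 ∨ G.Adj x.1 y.1) → (x.2 = y.2 ∨ H.Adj x.2 y.2) → P.Adj x y) :
    ∀ x y, Pᶜ.Adj x y → Gᶜ.Adj x.1 y.1 ∨ Hᶜ.Adj x.2 y.2 := by
  intro x y h
  rw [SimpleGraph.compl_adj] at h
  obtain ⟨hne, hnot⟩ := h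
  by_cases h1 : x.1 = y.1 ∨ G.Adj x.1 y.1
  · by_cases h2 : x.2 = y.2 ∨ H.Adj x.2 y.2
    · exact absurd (hP x y hne h1 h2) hnot
    · right
      rw [SimpleGraph.compl_adj]
      push Not at h2
      exact ⟨h2.1, h2.2⟩
  · left
    rw [SimpleGraph.compl_adj]
    push Not at h1
    exact ⟨h1.1, h1.2⟩

/-- **Super-multiplicativity of the uncertainty product for every product between the strong and the
disjunctive product** (strong, lexicographic in either order, disjunctive/co-normal): if the edges
of `P` contain those of `G ⊠ H` and are contained in those of the disjunctive product, then
`f_t(G) · f_t(H) ≤ f_t(P)` (`t ≥ 1`), because `P ≤ G ∗ H` and `Pᶜ ≤ Gᶜ ∗ Hᶜ`. -/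
theorem uncertaintyProduct_between_strong_disjunctive_ge {G : SimpleGraph V} {H : SimpleGraph W}
    {P : SimpleGraph (V × W)}
    (hlow : ∀ x y, x ≠ y → (x.1 = y.1 ∨ G.Adj x.1 y.1) → (x.2 = y.2 ∨ H.Adj x.2 y.2) → P.Adj x y)
    (hup : ∀ x y, P.Adj x y → G.Adj x.1 y.1 ∨ H.Adj x.2 y.2) {t : ℕ} (ht : 1 ≤ t) :
    (lasserreStableBound G t * lasserreStableBound Gᶜ t)
        * (lasserreStableBound H t * lasserreStableBound Hᶜ t)
      ≤ lasserreStableBound P t * lasserreStableBound Pᶜ t := by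
  have h1 : lasserreStableBound G t * lasserreStableBound H t ≤ lasserreStableBound P t :=
    mul_le_lasserreStableBound_of_adj hup ht
  have h2 : lasserreStableBound Gᶜ t * lasserreStableBound Hᶜ t ≤ lasserreStableBound Pᶜ t :=
    mul_le_lasserreStableBound_of_adj (compl_adj_imp_of_strong_le hlow) ht
  calc (lasserreStableBound G t * lasserreStableBound Gᶜ t)
        * (lasserreStableBound H t * lasserreStableBound Hᶜ t)
      = (lasserreStableBound G t * lasserreStableBound H t)
        * (lasserreStableBound Gᶜ t * lasserreStableBound Hᶜ t) := by ring
    _ ≤ lasserreStableBound P t * lasserreStableBound Pᶜ t :=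
        mul_le_mul h1 h2 (mul_nonneg (lasserreStableBound_nonneg Gᶜ t ht)
          (lasserreStableBound_nonneg Hᶜ t ht)) (lasserreStableBound_nonneg P t ht)

end Summit.PneNP.PneNP.Theorems.SosUncertainty
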